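import Summits.NavierStokesRegularity.NavierStokesRegularity.Theorems.LerayQuarterDissipationRecurrentReductionDRecurrent
import Summits.NavierStokesRegularity.NavierStokesRegularity.Theorems.LerayQuarterDissipationFiniteDissipationLiouvilleDssFactors
import HarnessLib

/-!
# Crux `FiniteDissipationLiouville` (stmt-NavierStokesRegularity-22144), line `birth`:
# CATEGORY ON THE SCALING HULL — tools (abstract Baire core; past-DSS bookkeeping)

Helper file (theorems only, `--supports` the crux), first of three
(`…HullCategoryTools` → `…HullCategory` → `…HullCategoryPortrait`). Let `𝒟_{C,K}` be the
finite-dissipation stratum of the route (Type-I ancient mild fields in the KNSS gauge with the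
quarter-rate dissipation law), acted on by the scaling flow `σ ↦ w_{e^σ}`,
`w_c(t,x) = c w(c²t, cx)` (`nsRescale`). The sequel proves by CATEGORY (Baire on the compact
scaling hull) that a uniformly recurrent member which is not discretely self-similar on the past
has scaling limits off any countable family of scaling orbits. This file supplies:

* `exists_lt_apply_eq_of_countable_cover` — ABSTRACT CORE: a curve `γ : ℝ → Y` in a Hausdorff
  space with compact orbit closure, returning to each of its points at arbitrarily late times,
  whose closure is covered by COUNTABLY many continuous curves cohering with `γ` under time
  translation, takes the same value at two different times (Baire: one compact arc has interior;
  a late return into it is a period).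
* past-DSS bookkeeping (on top of `…DssFactors.pastDss_mul/_inv`): `pastDss_pow`, `pastDss_zpow`
  (integer powers of a factor), `exists_rescaling_reduce_of_pastDss` (every rescaling of a `c`-past-DSS field is, on
  the past, a rescaling by a factor in `[1, c]`), `orbitLimit_eq_rescaling_of_pastDss` (THE
  SCALING ORBIT OF A PAST-DSS FIELD IS CLOSED: pointwise scaling limits are rescalings),
  `pastDss_of_rescalings_agree` (two rescalings agreeing on the past give a past-DSS relation),
  `continuousOn_uncurry_nsRescale`.

No summit is proved by this file; Navier–Stokes regularity is NOT proved by anything here.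

References: H. Furstenberg, *Recurrence in Ergodic Theory and Combinatorial Number Theory* (1981),
Ch. 1 §4 (uniform recurrence, minimal sets) [Furstenberg1981]; G. Koch, N. Nadirashvili,
G. Seregin, V. Šverák, Acta Math. 203 (2009) = arXiv:0709.3599, §4 (compactness of the Type-I
class) [KochNadirashviliSereginSverak2009]; Z. Bradshaw, T.-P. Tsai, Comm. PDE 42 (2017), §5
OP 5.1 [BradshawTsai2017CPDE]. Baire's category theorem: Mathlib (`BaireSpace`).
-/

noncomputable section

-- the summit and its single problem share the name (D-0017 nested layout)
set_option linter.dupNamespace false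

namespace Summit.NavierStokesRegularity.NavierStokesRegularity.Theorems.FiniteDissipationLiouville.HullCategory

open scoped Topology
open MeasureTheory Set Function Filter Metric TopologicalSpace Topology
open Literature.Analysis.FluidPDE
open Literature.Dynamics.TopologicalDynamics
open Summit.NavierStokesRegularity.NavierStokesRegularity.Theorems.RecurrentReductionD

/-! ### §1 The abstract core: Baire on a compact orbit closure -/

/-- **Baire on the orbit closure (abstract core).** Let `γ : ℝ → Y` be a curve in a
Hausdorff space whose orbit closure `closure (range γ)` is compact, which returns to each of its
points at arbitrarily late times (`γ (s' j) → γ s` along some `s' j → +∞`), and let `δ i`,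
`i : ι` countable, be continuous curves covering that closure and COHERENT with `γ`
(`γ s = δ i σ ⇒ γ (s + τ) = δ i (σ + τ)` for all `τ` — orbits of one flow). Then `γ a = γ b`
for some `a < b` (the curve is periodic). Proof: the closure is the countable union of the
compact arcs `δ i '' [−n, n]`; by Baire's theorem one arc has non-empty interior in the closure,
which the dense curve `γ` enters at some time `s₀` and — by recurrence — again at a time
`s' > s₀ + 2n`; coherence along the arc turns the two visits into two parameters of `δ i` in
`[−n, n]` differing by `s' − s₀ > 2n` from each other's translate, whence a period of `γ`.
[cite: Furstenberg1981, Ch. 1 §4 (minimal sets; recurrence)] -/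
theorem exists_lt_apply_eq_of_countable_cover {Y : Type*} [TopologicalSpace Y] [T2Space Y]
    {γ : ℝ → Y} (hK : IsCompact (closure (range γ)))
    (hrec : ∀ s : ℝ, ∃ s' : ℕ → ℝ, Tendsto s' atTop atTop ∧
      Tendsto (fun j => γ (s' j)) atTop (𝓝 (γ s)))
    {ι : Type*} [Countable ι] (δ : ι → ℝ → Y) (hδ : ∀ i, Continuous (δ i))
    (hcover : closure (range γ) ⊆ ⋃ i, range (δ i))
    (hcoh : ∀ i s σ, γ s = δ i σ → ∀ τ : ℝ, γ (s + τ) = δ i (σ + τ)) :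
    ∃ a b : ℝ, a < b ∧ γ a = γ b := by
  classical
  set K : Set Y := closure (range γ) with hKdef
  haveI : CompactSpace K := isCompact_iff_compactSpace.1 hK
  haveI : Nonempty K := ⟨⟨γ 0, subset_closure ⟨0, rfl⟩⟩⟩
  -- the closed arcs
  set F : ι × ℕ → Set K := fun p => ((↑) : K → Y) ⁻¹' (δ p.1 '' Icc (-(p.2 : ℝ)) p.2) with hF
  have hFc : ∀ p, IsClosed (F p) := fun p =>
    ((isCompact_Icc.image (hδ p.1)).isClosed).preimage continuous_subtype_val
  have hFU : ⋃ p, F p = univ := by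
    refine eq_univ_of_forall fun k => ?_
    obtain ⟨i, hi⟩ := mem_iUnion.1 (hcover k.2)
    obtain ⟨σ, hσ⟩ := hi
    obtain ⟨n, hn⟩ := exists_nat_ge |σ|
    refine mem_iUnion.2 ⟨(i, n), ⟨σ, ⟨?_, ?_⟩, hσ⟩⟩
    · linarith [neg_abs_le σ]
    · linarith [le_abs_self σ]
  obtain ⟨⟨i, n⟩, hint⟩ := nonempty_interior_of_iUnion_of_closed hFc hFU
  -- the interior is `U ∩ K` for an open `U` of `Y`
  obtain ⟨U, hUo, hUeq⟩ := isOpen_induced_iff.1 (isOpen_interior (s := F (i, n)))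
  obtain ⟨k₀, hk₀⟩ := hint
  have hk₀U : (k₀ : Y) ∈ U := by
    have : k₀ ∈ ((↑) : K → Y) ⁻¹' U := by rw [hUeq]; exact hk₀
    exact this
  -- the dense curve enters `U` at some time `s₀`
  obtain ⟨y, hyU, ⟨s₀, rfl⟩⟩ := mem_closure_iff.1 k₀.2 U hUo hk₀U
  have hmemF : ∀ s : ℝ, γ s ∈ U → ∃ σ ∈ Icc (-(n : ℝ)) n, δ i σ = γ s := by
    intro s hs
    have h1 : (⟨γ s, subset_closure ⟨s, rfl⟩⟩ : K) ∈ ((↑) : K → Y) ⁻¹' U := hs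
    rw [hUeq] at h1
    have h2 : (⟨γ s, subset_closure ⟨s, rfl⟩⟩ : K) ∈ F (i, n) := interior_subset h1
    obtain ⟨σ, hσ, hσe⟩ := h2
    exact ⟨σ, hσ, hσe⟩
  obtain ⟨σ₀, hσ₀, hσ₀e⟩ := hmemF s₀ hyU
  -- recurrence: a late return into `U`
  obtain ⟨s', hs'top, hs'lim⟩ := hrec s₀
  have hev₁ : ∀ᶠ j in atTop, γ (s' j) ∈ U := hs'lim (hUo.mem_nhds hyU)
  have hev₂ : ∀ᶠ j in atTop, s₀ + 2 * n + 1 ≤ s' j := hs'top.eventually_ge_atTop _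
  obtain ⟨j, hj₁, hj₂⟩ := (hev₁.and hev₂).exists
  obtain ⟨σ₁, hσ₁, hσ₁e⟩ := hmemF (s' j) hj₁
  -- coherence along the arc
  have hc₀ := hcoh i s₀ σ₀ hσ₀e.symm
  refine ⟨s₀ + (σ₁ - σ₀), s' j, ?_, ?_⟩
  · have : σ₁ - σ₀ ≤ 2 * n := by linarith [hσ₁.2, hσ₀.1]
    linarith
  · rw [hc₀ (σ₁ - σ₀), add_sub_cancel, hσ₁e]

/-! ### §2 Past-DSS bookkeeping: integer powers, reduction of factors, closed orbits -/

/-- A past-DSS relation with factor `c > 0` holds with every natural power `c ^ m`. [folklore] -/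
theorem pastDss_pow {c : ℝ} (hc : 0 < c) {u : ℝ → EuclideanSpace ℝ (Fin 3) → EuclideanSpace ℝ (Fin 3)}
    (h : ∀ t : ℝ, t < 0 → ∀ x, c • u (c ^ 2 * t) (c • x) = u t x) (m : ℕ) :
    ∀ t : ℝ, t < 0 → ∀ x, c ^ m • u ((c ^ m) ^ 2 * t) (c ^ m • x) = u t x := by
  induction m with
  | zero => intro t _ x; simp
  | succ m ih =>
    rw [pow_succ]
    exact FiniteDissipationLiouville.Birth.pastDss_mul (pow_pos hc m) ih h

/-- A past-DSS relation with factor `c > 0` holds with every INTEGER power `c ^ m`. [folklore] -/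
theorem pastDss_zpow {c : ℝ} (hc : 0 < c) {u : ℝ → EuclideanSpace ℝ (Fin 3) → EuclideanSpace ℝ (Fin 3)}
    (h : ∀ t : ℝ, t < 0 → ∀ x, c • u (c ^ 2 * t) (c • x) = u t x) (m : ℤ) :
    ∀ t : ℝ, t < 0 → ∀ x, c ^ m • u ((c ^ m) ^ 2 * t) (c ^ m • x) = u t x := by
  obtain ⟨k, rfl | rfl⟩ := m.eq_nat_or_neg
  · simpa only [zpow_natCast] using pastDss_pow hc h k
  · have e : c ^ (-(k : ℤ)) = (c⁻¹) ^ k := by rw [zpow_neg, zpow_natCast, inv_pow]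
    rw [e]
    exact pastDss_pow (inv_pos.2 hc) (FiniteDissipationLiouville.Birth.pastDss_inv hc h) k

/-- **Reduction of a scaling factor modulo the period**: if `u` is past-DSS with factor `c > 1`,
every rescaling `u_l`, `l > 0`, agrees on the past with a rescaling `u_r` by a factor
`r ∈ [1, c]` (`l = c^m r`). [folklore] -/
theorem exists_rescaling_reduce_of_pastDss {c : ℝ} (hc : 1 < c)
    {u : ℝ → EuclideanSpace ℝ (Fin 3) → EuclideanSpace ℝ (Fin 3)}
    (h : ∀ t : ℝ, t < 0 → ∀ x, c • u (c ^ 2 * t) (c • x) = u t x) {l : ℝ} (hl : 0 < l) :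
    ∃ r ∈ Icc (1 : ℝ) c, ∀ t : ℝ, t < 0 → ∀ x, nsRescale l u t x = nsRescale r u t x := by
  have hc0 : 0 < c := one_pos.trans hc
  have hlogc : 0 < Real.log c := Real.log_pos hc
  set m : ℤ := ⌊Real.log l / Real.log c⌋ with hm
  set r : ℝ := l / c ^ m with hr
  have hcm : 0 < c ^ m := zpow_pos hc0 m
  have hr0 : 0 < r := div_pos hl hcm
  -- `1 ≤ r ≤ c` from `m ≤ log l / log c < m + 1`
  have hlogr : Real.log r = Real.log l - m * Real.log c := by
    rw [hr, Real.log_div hl.ne' hcm.ne', Real.log_zpow]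
  have hr1 : 1 ≤ r := by
    have h1 : (m : ℝ) ≤ Real.log l / Real.log c := Int.floor_le _
    have h2 : (m : ℝ) * Real.log c ≤ Real.log l := by rwa [le_div_iff₀ hlogc] at h1
    have h3 : 0 ≤ Real.log r := by rw [hlogr]; linarith
    rwa [Real.log_nonneg_iff hr0] at h3
  have hrc : r ≤ c := by
    have h1 : Real.log l / Real.log c < (m : ℝ) + 1 := Int.lt_floor_add_one _
    have h2 : Real.log l < ((m : ℝ) + 1) * Real.log c := by rwa [div_lt_iff₀ hlogc] at h1
    have h3 : Real.log r ≤ Real.log c := by rw [hlogr]; linarith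
    exact (Real.log_le_log_iff hr0 hc0).1 h3
  refine ⟨r, ⟨hr1, hrc⟩, fun t ht x => ?_⟩
  -- `u_l = (u_{c^m})_r = u_r` on the past
  have hlr : l = c ^ m * r := by rw [hr, mul_div_cancel₀ _ hcm.ne']
  have hrt : r ^ 2 * t < 0 := mul_neg_of_pos_of_neg (by positivity) ht
  rw [hlr, nsRescale_mul, nsRescale_apply, nsRescale_apply, nsRescale_apply,
    pastDss_zpow hc0 h m (r ^ 2 * t) hrt (r • x)]

/-- **The scaling orbit of a past-DSS field is closed**: if `u` (continuous on the open past) is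
past-DSS with factor `c > 1`, every POINTWISE limit on the past of rescalings `u_{l_k}`,
`l_k > 0`, agrees on the past with a rescaling `u_{c₀}`, `c₀ ∈ [1, c]` (reduce `l_k` modulo the
period to `r_k ∈ [1, c]`, extract `r_k → c₀`, continuity). [folklore] -/
theorem orbitLimit_eq_rescaling_of_pastDss {c : ℝ} (hc : 1 < c)
    {u : ℝ → EuclideanSpace ℝ (Fin 3) → EuclideanSpace ℝ (Fin 3)}
    (hcont : ContinuousOn (uncurry u) (Iio 0 ×ˢ univ))
    (h : ∀ t : ℝ, t < 0 → ∀ x, c • u (c ^ 2 * t) (c • x) = u t x)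
    (l : ℕ → ℝ) (hl : ∀ k, 0 < l k) (W : ℝ → EuclideanSpace ℝ (Fin 3) → EuclideanSpace ℝ (Fin 3))
    (hpt : ∀ t < 0, ∀ x, Tendsto (fun k => nsRescale (l k) u t x) atTop (𝓝 (W t x))) :
    ∃ c₀ ∈ Icc (1 : ℝ) c, ∀ t : ℝ, t < 0 → ∀ x, W t x = nsRescale c₀ u t x := by
  choose r hr hru using fun k => exists_rescaling_reduce_of_pastDss hc h (hl k)
  obtain ⟨c₀, hc₀, φ, hφ, hrφ⟩ := tendsto_subseq_of_bounded (x := r) (isBounded_Icc 1 c) hr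
  rw [closure_Icc] at hc₀
  refine ⟨c₀, hc₀, fun t ht x => ?_⟩
  have hc₀0 : 0 < c₀ := one_pos.trans_le hc₀.1
  -- along the subsequence, `u_{l_{φ k}} t x = u_{r_{φ k}} t x → u_{c₀} t x`
  have hmem : (c₀ ^ 2 * t, c₀ • x) ∈ Iio (0 : ℝ) ×ˢ (univ : Set (EuclideanSpace ℝ (Fin 3))) :=
    ⟨mul_neg_of_pos_of_neg (by positivity) ht, mem_univ _⟩
  have hca : ContinuousAt (uncurry u) (c₀ ^ 2 * t, c₀ • x) :=
    hcont.continuousAt ((isOpen_Iio.prod isOpen_univ).mem_nhds hmem)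
  have h1 : Tendsto (fun k => ((r (φ k)) ^ 2 * t, r (φ k) • x)) atTop (𝓝 (c₀ ^ 2 * t, c₀ • x)) :=
    ((hrφ.pow 2).mul_const t).prodMk_nhds (hrφ.smul_const x)
  have h2 : Tendsto (fun k => nsRescale (r (φ k)) u t x) atTop (𝓝 (nsRescale c₀ u t x)) := by
    simp only [nsRescale_apply]
    exact hrφ.smul (hca.tendsto.comp h1)
  have h3 : Tendsto (fun k => nsRescale (l (φ k)) u t x) atTop (𝓝 (nsRescale c₀ u t x)) :=
    h2.congr fun k => (hru (φ k) t ht x).symm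
  exact tendsto_nhds_unique ((hpt t ht x).comp hφ.tendsto_atTop) h3


/-- **Two rescalings agreeing on the past give a past-DSS relation**: if `u_{e^a} = u_{e^b}` on
the open past with `a < b`, then `u` is past-DSS with factor `e^{b−a} > 1`. [folklore] -/
theorem pastDss_of_rescalings_agree {u : ℝ → EuclideanSpace ℝ (Fin 3) → EuclideanSpace ℝ (Fin 3)}
    {a b : ℝ}
    (h : ∀ t : ℝ, t < 0 → ∀ x, nsRescale (Real.exp a) u t x = nsRescale (Real.exp b) u t x) :
    ∀ t : ℝ, t < 0 → ∀ x,
      Real.exp (b - a) • u (Real.exp (b - a) ^ 2 * t) (Real.exp (b - a) • x) = u t x := by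
  intro t ht x
  have ha : 0 < Real.exp a := Real.exp_pos a
  have ht' : (Real.exp a)⁻¹ ^ 2 * t < 0 := mul_neg_of_pos_of_neg (by positivity) ht
  have h1 := h ((Real.exp a)⁻¹ ^ 2 * t) ht' ((Real.exp a)⁻¹ • x)
  simp only [nsRescale_apply, smul_smul] at h1
  have e1 : Real.exp a ^ 2 * ((Real.exp a)⁻¹ ^ 2 * t) = t := by field_simp
  have e2 : Real.exp a * (Real.exp a)⁻¹ = 1 := mul_inv_cancel₀ ha.ne'
  have e3 : Real.exp b * (Real.exp a)⁻¹ = Real.exp (b - a) := by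
    rw [Real.exp_sub, div_eq_mul_inv]
  have e4 : Real.exp b ^ 2 * ((Real.exp a)⁻¹ ^ 2 * t) = Real.exp (b - a) ^ 2 * t := by
    rw [← e3]; ring
  rw [e1, e2, one_smul, e4, e3] at h1
  have h2 := congrArg (fun v => (Real.exp a)⁻¹ • v) h1
  simp only [smul_smul, inv_mul_cancel₀ ha.ne', one_smul] at h2
  have e5 : (Real.exp a)⁻¹ * Real.exp b = Real.exp (b - a) := by
    rw [Real.exp_sub, div_eq_inv_mul]
  rw [e5] at h2
  exact h2.symm

/-- Rescaling preserves continuity on the open past `(−∞, 0) × ℝ³` (the parabolic dilation by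
`c > 0` maps the open past into itself). [folklore] -/
theorem continuousOn_uncurry_nsRescale {u : ℝ → EuclideanSpace ℝ (Fin 3) → EuclideanSpace ℝ (Fin 3)}
    (hu : ContinuousOn (uncurry u) (Iio 0 ×ˢ univ)) {c : ℝ} (hc : 0 < c) :
    ContinuousOn (uncurry (nsRescale c u)) (Iio 0 ×ˢ univ) := by
  have hmaps : MapsTo (fun q : ℝ × EuclideanSpace ℝ (Fin 3) => (c ^ 2 * q.1, c • q.2))
      (Iio (0 : ℝ) ×ˢ (univ : Set (EuclideanSpace ℝ (Fin 3))))
      (Iio (0 : ℝ) ×ˢ (univ : Set (EuclideanSpace ℝ (Fin 3)))) := fun q hq =>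
    ⟨mul_neg_of_pos_of_neg (pow_pos hc 2) hq.1, mem_univ _⟩
  have hd : Continuous fun q : ℝ × EuclideanSpace ℝ (Fin 3) => (c ^ 2 * q.1, c • q.2) :=
    (continuous_fst.const_mul (c ^ 2)).prodMk (continuous_snd.const_smul c)
  have h : ContinuousOn (fun q : ℝ × EuclideanSpace ℝ (Fin 3) => c • uncurry u (c ^ 2 * q.1, c • q.2))
      (Iio (0 : ℝ) ×ˢ (univ : Set (EuclideanSpace ℝ (Fin 3)))) :=
    (hu.comp hd.continuousOn hmaps).const_smul c
  refine h.congr fun q _ => ?_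
  simp only [uncurry, nsRescale_apply]


end Summit.NavierStokesRegularity.NavierStokesRegularity.Theorems.FiniteDissipationLiouville.HullCategory

end
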